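import Summits.QuantumFields.GaugeBoot.GaugeOrbitPolynomials
import HarnessLib

/-!
# `U(1)` loop equations with gauge-invariant POLYNOMIAL test functions determine the gauge-invariant sector (gauge-boot, L1 supplement)

HONEST FRAMING (cell `pub-gaugeboot`, page 1 of every file): the venture produces certified bounds
on lattice expectations at stated coupling, gauge group, dimension and torus size; NOT a mass gap,
NOT a continuum limit, NOT a string tension; NOT Yang–Mills-summit-bearing (barriers
`FixedCouplingUltralocality`, `PerturbativeInvisibility`). This module is a structural statement
about lattice gauge measures at stated coupling; it certifies no number.

## Content — the polynomial (bootstrap) test class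

The rows a bootstrap writes are Schwinger–Dyson identities `∫ f' dμ = β ∫ f S' dμ` with `f` a
GAUGE-INVARIANT POLYNOMIAL observable (Wilson loops, their products and linear combinations —
`polyFunctions` ∩ `IsGaugeInvariant`). Along a CENTRAL exponential family exhausting `G`
(`ρ(k_a t) = e^{tX_a}`, all `k_a t` central — the abelian case) these rows are complete:

* ★★ `eq_wilsonMeasure_iff_sdOn_gaugeInvariantPoly` — torus `(ℤ/L)^d`, gauge-invariant probability
  state: rows for gauge-invariant polynomial test functions ⇔ the state is Wilson's measure
  (invariant polynomial rows ⇒ all polynomial rows by gauge averaging of test functions,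
  `PolynomialOrbitAveraging` + `GaugeOrbitPolynomials`; polynomial rows ⇒ all rows ⇒ Wilson,
  `PolynomialSchwingerDyson`, `SchwingerDysonDeterminesWilson`);
* ★★★ `integral_eq_wilson_of_sdOn_gaugeInvariantPoly`, `avgMeasure_eq_wilsonMeasure_of_sdOn_gaugeInvariantPoly`
  — ANY probability state with those rows: its gauge average IS Wilson's measure, so EVERY
  gauge-invariant continuous observable has Wilson's expectation;
* ★★★ `eq_wilsonMeasure_iff_sdOn_gaugeInvariantPoly_u1`, ★★★ `integral_eq_wilson_of_sdOn_gaugeInvariantPoly_u1`,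
  `avgMeasure_eq_wilsonMeasure_of_sdOn_gaugeInvariantPoly_u1` — UNCONDITIONAL: compact `U(1)`
  lattice gauge theory on `(ℤ/L)^d`, every `d`, `L ≥ 1`, every real `β`, shifts `U ↦ U[e ↦ e^{tX}U_e]`,
  `X ∈ 𝔲(1)`. THE ABELIAN LOOP EQUATIONS PLUS REALISABILITY BY A PROBABILITY MEASURE DETERMINE EVERY
  GAUGE-INVARIANT EXPECTATION IN FINITE VOLUME — a theorem-level answer, in finite volume, to the
  question studied numerically by Li–Zhou (arXiv:2404.17071): "whether the constraints from loop
  equations and positivity are strong enough to solve [the abelian] lattice gauge theories";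
* ★★★ `sdOn_gaugeInvariantPoly_iff_mem_ymGibbsMeasures_u1`, `avgMeasure_mem_ymGibbsMeasures_of_sdOn_gaugeInvariantPoly_u1`
  — `U(1)` on `ℤ^d`: for a gauge-invariant probability state the same rows hold iff it is a DLR
  state; for any probability solution the gauge average is a DLR state (unique at strong coupling,
  `HaarShiftUniqueness`).

Contrast (lean3 gen 72, `AdInvariantSchwingerDysonRows`): along the traceless directions of
`SU(N)`/`U(N)` the gauge-invariant rows are `0 = β·0`. Abelian: complete; traceless: empty.

References: Z. Li, S. Zhou, arXiv:2404.17071 §2, §4; P. Anderson, M. Kruczenski, Nucl. Phys. B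
921 (2017) §2; V. Kazakov, Z. Zheng, arXiv:2203.11360 §2. Folklore (no printed finite-volume
completeness statement was found).
-/

noncomputable section

open MeasureTheory
open Literature.MathematicalPhysics.QuantumFieldTheory (haarProbability LatticeRep)

namespace Summit.QuantumFields.GaugeBoot

/-! ## The torus -/

section Torus

open Literature.MathematicalPhysics.QuantumFieldTheory (Site Edge GaugeConfig gaugeTransform
  IsGaugeInvariant wilsonAction wilsonMeasure wilsonAction_gaugeTransform)
open Literature.MathematicalPhysics.QuantumLattice (unitaryFundamentalRep unitaryFundamentalLatticeRep)

variable {d L : ℕ} {G : Type*} [Group G] [TopologicalSpace G] [IsTopologicalGroup G]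
  [CompactSpace G] [MeasurableSpace G] [BorelSpace G] [T2Space G] [SecondCountableTopology G]
  [Nonempty G] (r : LatticeRep G) {K : Type*} {k : K → ℝ → G}

/-- ★★ **Torus, gauge-invariant state, central exponential family exhausting `G`: the rows for
GAUGE-INVARIANT POLYNOMIAL test functions hold iff the state is Wilson's measure.** (`r` faithful
unitary continuous, `ρ(k_a t) = e^{tX_a}`, every `g ∈ G` some `k_a t`, all `k_a t` central, any
real `β`, `L ≥ 1`.) [folklore] -/
theorem eq_wilsonMeasure_iff_sdOn_gaugeInvariantPoly [NeZero L] (hkc : ∀ a, Continuous (k a))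
    (hk : ∀ a s t, k a (s + t) = k a s * k a t) {X : K → Matrix (Fin r.N) (Fin r.N) ℂ}
    (hX : ∀ a t, r.ρ (k a t) = NormedSpace.exp ((t : ℂ) • X a)) (hG : ∀ g : G, ∃ a t, k a t = g)
    (hcen : ∀ (a : K) (t : ℝ) (g : G), g * k a t = k a t * g) (β : ℝ)
    (μ : Measure (GaugeConfig d L G)) [IsProbabilityMeasure μ]
    (hμinv : ∀ g : Site d L → G, μ.map (gaugeTransform g) = μ) :
    μ = wilsonMeasure r.ρ β ↔
      IsSchwingerDysonStateOn (fun f => f ∈ polyFunctions (ι := Edge d L) r ∧ IsGaugeInvariant f) k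
        (fun _ => wilsonAction r.ρ) β μ := by
  have hS : ∀ _ : Edge d L, wilsonAction (d := d) (L := L) r.ρ ∈ polyFunctions (ι := Edge d L) r :=
    fun _ => wilsonAction_mem_polyFunctions r
  constructor
  · intro hμ
    have hSd : ∀ (e : Edge d L) (a : K), ∃ S' : GaugeConfig d L G → ℝ, Continuous S' ∧
        ∀ U, HasDerivAt (fun t => wilsonAction r.ρ (Function.update U e (k a t * U e))) (S' U) 0 :=
      fun e a => exists_hasDerivAt_of_mem_polyFunctions r (hk a) (hX a) e (hS e)
    exact ((eq_wilsonMeasure_iff_sd r.ρ hkc hk hG r.continuous hSd β μ).1 hμ).on _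
  · intro hμ
    have hpoly : IsPolySchwingerDysonState r k (fun _ => wilsonAction r.ρ) β μ :=
      hμ.isPolySchwingerDysonState_of_invariant r hkc hk gaugeTransform_action.2
        gaugeTransform_action.1 (gaugeTransform_hgen r)
        (fun h e a t U => gaugeTransform_update_mul_of_central (hcen a t) h U e)
        (fun h _ U => wilsonAction_gaugeTransform r.ρ h U) hμinv
    exact eq_wilsonMeasure_of_sd r.ρ hkc hk hG r.continuous
      (hpoly.isSchwingerDysonState r hkc hk hX hG hS)

/-- ★★★ **Torus, ANY state: the gauge average of a probability solution of the gauge-invariant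
polynomial rows IS Wilson's measure.** [folklore] -/
theorem avgMeasure_eq_wilsonMeasure_of_sdOn_gaugeInvariantPoly [NeZero L]
    (hkc : ∀ a, Continuous (k a)) (hk : ∀ a s t, k a (s + t) = k a s * k a t)
    {X : K → Matrix (Fin r.N) (Fin r.N) ℂ} (hX : ∀ a t, r.ρ (k a t) = NormedSpace.exp ((t : ℂ) • X a))
    (hG : ∀ g : G, ∃ a t, k a t = g) (hcen : ∀ (a : K) (t : ℝ) (g : G), g * k a t = k a t * g)
    {β : ℝ} {μ : Measure (GaugeConfig d L G)} [IsProbabilityMeasure μ]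
    (hμ : IsSchwingerDysonStateOn (fun f => f ∈ polyFunctions (ι := Edge d L) r ∧ IsGaugeInvariant f)
      k (fun _ => wilsonAction r.ρ) β μ) :
    avgMeasure (gaugeTransform (d := d) (L := L) (G := G)) μ = wilsonMeasure r.ρ β := by
  haveI := isProbabilityMeasure_avgMeasure (act := gaugeTransform (d := d) (L := L) (G := G))
    gaugeTransform_action.2 μ
  have hpoly : IsPolySchwingerDysonState r k (fun _ => wilsonAction r.ρ) β
      (avgMeasure (gaugeTransform (d := d) (L := L) (G := G)) μ) :=
    hμ.isPolySchwingerDysonState_avgMeasure r hkc hk gaugeTransform_action.2 gaugeTransform_action.1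
      (gaugeTransform_hgen r) (fun h e a t U => gaugeTransform_update_mul_of_central (hcen a t) h U e)
      (fun h _ U => wilsonAction_gaugeTransform r.ρ h U)
  exact eq_wilsonMeasure_of_sd r.ρ hkc hk hG r.continuous (hpoly.isSchwingerDysonState r hkc hk hX hG
    fun _ => wilsonAction_mem_polyFunctions r)

/-- ★★★ **Torus, ANY state: the rows for gauge-invariant POLYNOMIAL test functions determine
every gauge-invariant expectation** — `∫ F dμ = ∫ F dμ_Wilson` for every gauge-invariant continuous
`F`. [folklore] -/
theorem integral_eq_wilson_of_sdOn_gaugeInvariantPoly [NeZero L] (hkc : ∀ a, Continuous (k a))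
    (hk : ∀ a s t, k a (s + t) = k a s * k a t) {X : K → Matrix (Fin r.N) (Fin r.N) ℂ}
    (hX : ∀ a t, r.ρ (k a t) = NormedSpace.exp ((t : ℂ) • X a)) (hG : ∀ g : G, ∃ a t, k a t = g)
    (hcen : ∀ (a : K) (t : ℝ) (g : G), g * k a t = k a t * g) {β : ℝ}
    {μ : Measure (GaugeConfig d L G)} [IsProbabilityMeasure μ]
    (hμ : IsSchwingerDysonStateOn (fun f => f ∈ polyFunctions (ι := Edge d L) r ∧ IsGaugeInvariant f)
      k (fun _ => wilsonAction r.ρ) β μ)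
    (F : GaugeConfig d L G → ℝ) (hF : Continuous F) (hFi : IsGaugeInvariant F) :
    ∫ U, F U ∂μ = ∫ U, F U ∂(wilsonMeasure r.ρ β) := by
  rw [← avgMeasure_eq_wilsonMeasure_of_sdOn_gaugeInvariantPoly r hkc hk hX hG hcen hμ,
    integral_avgMeasure_of_invariant gaugeTransform_action.2 hF hFi μ]

/-! ### Compact `U(1)` -/

/-- ★★★ **`U(1)` ON THE TORUS, GAUGE-INVARIANT STATE: the loop equations for gauge-invariant
POLYNOMIAL observables hold iff the state is Wilson's measure** (every `d`, `L ≥ 1`, real `β`;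
shifts `U ↦ U[e ↦ e^{tX} U_e]`, `X ∈ 𝔲(1)`). UNCONDITIONAL. [folklore] -/
theorem eq_wilsonMeasure_iff_sdOn_gaugeInvariantPoly_u1 [NeZero L] (β : ℝ)
    (μ : Measure (GaugeConfig d L (Matrix.unitaryGroup (Fin 1) ℂ))) [IsProbabilityMeasure μ]
    (hμinv : ∀ g : Site d L → Matrix.unitaryGroup (Fin 1) ℂ, μ.map (gaugeTransform g) = μ) :
    μ = wilsonMeasure (unitaryFundamentalRep (Fin 1) ℂ) β ↔
      IsSchwingerDysonStateOn
        (fun f => f ∈ polyFunctions (ι := Edge d L) (unitaryFundamentalLatticeRep 1) ∧ IsGaugeInvariant f)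
        (uExp 1) (fun _ => wilsonAction (unitaryFundamentalRep (Fin 1) ℂ)) β μ :=
  eq_wilsonMeasure_iff_sdOn_gaugeInvariantPoly (unitaryFundamentalLatticeRep 1) (continuous_uExp 1)
    (uExp_add 1) (X := fun X : UGenerator 1 => (X : Matrix (Fin 1) (Fin 1) ℂ)) (rho_uExp 1)
    (fun g => exists_uExp_eq 1 g) (fun _ _ g => unitaryGroup_fin_one_comm g _) β μ hμinv

/-- ★★★ **`U(1)` ON THE TORUS, ANY STATE: THE LOOP EQUATIONS FOR GAUGE-INVARIANT POLYNOMIAL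
OBSERVABLES PLUS REALISABILITY BY A PROBABILITY MEASURE DETERMINE EVERY GAUGE-INVARIANT
EXPECTATION** (every `d`, `L ≥ 1`, real `β`): `∫ F dμ = ∫ F dμ_Wilson` for every gauge-invariant
continuous `F`. UNCONDITIONAL. [folklore] -/
theorem integral_eq_wilson_of_sdOn_gaugeInvariantPoly_u1 [NeZero L] {β : ℝ}
    {μ : Measure (GaugeConfig d L (Matrix.unitaryGroup (Fin 1) ℂ))} [IsProbabilityMeasure μ]
    (hμ : IsSchwingerDysonStateOn
      (fun f => f ∈ polyFunctions (ι := Edge d L) (unitaryFundamentalLatticeRep 1) ∧ IsGaugeInvariant f)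
      (uExp 1) (fun _ => wilsonAction (unitaryFundamentalRep (Fin 1) ℂ)) β μ)
    (F : GaugeConfig d L (Matrix.unitaryGroup (Fin 1) ℂ) → ℝ) (hF : Continuous F)
    (hFi : IsGaugeInvariant F) :
    ∫ U, F U ∂μ = ∫ U, F U ∂(wilsonMeasure (unitaryFundamentalRep (Fin 1) ℂ) β) :=
  integral_eq_wilson_of_sdOn_gaugeInvariantPoly (unitaryFundamentalLatticeRep 1) (continuous_uExp 1)
    (uExp_add 1) (X := fun X : UGenerator 1 => (X : Matrix (Fin 1) (Fin 1) ℂ)) (rho_uExp 1)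
    (fun g => exists_uExp_eq 1 g) (fun _ _ g => unitaryGroup_fin_one_comm g _) hμ F hF hFi

/-- ★★★ **`U(1)` on the torus, any state: the gauge average of a probability solution of the
gauge-invariant polynomial loop equations is Wilson's measure.** [folklore] -/
theorem avgMeasure_eq_wilsonMeasure_of_sdOn_gaugeInvariantPoly_u1 [NeZero L] {β : ℝ}
    {μ : Measure (GaugeConfig d L (Matrix.unitaryGroup (Fin 1) ℂ))} [IsProbabilityMeasure μ]
    (hμ : IsSchwingerDysonStateOn
      (fun f => f ∈ polyFunctions (ι := Edge d L) (unitaryFundamentalLatticeRep 1) ∧ IsGaugeInvariant f)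
      (uExp 1) (fun _ => wilsonAction (unitaryFundamentalRep (Fin 1) ℂ)) β μ) :
    avgMeasure (gaugeTransform (d := d) (L := L) (G := Matrix.unitaryGroup (Fin 1) ℂ)) μ =
      wilsonMeasure (unitaryFundamentalRep (Fin 1) ℂ) β :=
  avgMeasure_eq_wilsonMeasure_of_sdOn_gaugeInvariantPoly (unitaryFundamentalLatticeRep 1)
    (continuous_uExp 1) (uExp_add 1) (X := fun X : UGenerator 1 => (X : Matrix (Fin 1) (Fin 1) ℂ))
    (rho_uExp 1) (fun g => exists_uExp_eq 1 g) (fun _ _ g => unitaryGroup_fin_one_comm g _) hμ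

end Torus

/-! ## `ℤ^d` -/

section Zd

open Literature.MathematicalPhysics.QuantumLattice
open Literature.Probability.LatticeModels (Site)

variable {d : ℕ} {G : Type*} [Group G] [TopologicalSpace G] [IsTopologicalGroup G]
  [CompactSpace G] [MeasurableSpace G] [BorelSpace G] [SecondCountableTopology G] [T2Space G]
  (r : LatticeRep G) {K : Type*} {k : K → ℝ → G}

/-- ★★ **`ℤ^d`, gauge-invariant state, central exponential family exhausting `G`: the rows for
gauge-invariant POLYNOMIAL test functions hold iff the state is DLR.** [folklore] -/
theorem sdOn_gaugeInvariantPoly_iff_mem_ymGibbsMeasures (hkc : ∀ a, Continuous (k a))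
    (hk : ∀ a s t, k a (s + t) = k a s * k a t) {X : K → Matrix (Fin r.N) (Fin r.N) ℂ}
    (hX : ∀ a t, r.ρ (k a t) = NormedSpace.exp ((t : ℂ) • X a)) (hG : ∀ g : G, ∃ a t, k a t = g)
    (hcen : ∀ (a : K) (t : ℝ) (g : G), g * k a t = k a t * g) (β : ℝ)
    (μ : Measure (LGConfig d G)) [IsProbabilityMeasure μ]
    (hμinv : ∀ g : Site d → G, μ.map (gaugeTransformZd g) = μ) :
    IsSchwingerDysonStateOn (fun f => f ∈ polyFunctions (ι := ZdEdge d) r ∧ IsZdGaugeInvariant f) k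
        (fun e => wilsonBoundaryAction r.ρ {e}) β μ ↔
      μ ∈ ymGibbsMeasures r.ρ β := by
  have hS : ∀ e : ZdEdge d, wilsonBoundaryAction r.ρ {e} ∈ polyFunctions (ι := ZdEdge d) r :=
    fun e => wilsonBoundaryAction_mem_polyFunctions r {e}
  have hSd : ∀ (e : ZdEdge d) (a : K), ∃ S' : LGConfig d G → ℝ, Continuous S' ∧
      ∀ U, HasDerivAt (fun t => wilsonBoundaryAction r.ρ {e} (Function.update U e (k a t * U e)))
        (S' U) 0 :=
    fun e a => exists_hasDerivAt_of_mem_polyFunctions r (hk a) (hX a) e (hS e)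
  rw [← isSchwingerDysonState_iff_mem_ymGibbsMeasures r.ρ hkc hk hG r.continuous hSd β μ]
  constructor
  · intro hμ
    have hpoly : IsPolySchwingerDysonState r k (fun e => wilsonBoundaryAction r.ρ {e}) β μ :=
      hμ.isPolySchwingerDysonState_of_invariant r hkc hk gaugeTransformZd_action.2
        gaugeTransformZd_action.1 (gaugeTransformZd_hgen r)
        (fun h e a t U => gaugeTransformZd_update_mul_of_central (hcen a t) h U e)
        (fun h e U => wilsonBoundaryAction_gaugeTransformZd r.ρ {e} h U) hμinv
    exact hpoly.isSchwingerDysonState r hkc hk hX hG hS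
  · exact fun hμ => hμ.on _

/-- ★★ **`ℤ^d`, ANY state: the gauge average of a probability solution of the gauge-invariant
polynomial rows is a DLR state** (and agrees with the solution on every gauge-invariant continuous
observable, `integral_avgMeasure_gaugeTransformZd_of_invariant`). [folklore] -/
theorem avgMeasure_mem_ymGibbsMeasures_of_sdOn_gaugeInvariantPoly (hkc : ∀ a, Continuous (k a))
    (hk : ∀ a s t, k a (s + t) = k a s * k a t) {X : K → Matrix (Fin r.N) (Fin r.N) ℂ}
    (hX : ∀ a t, r.ρ (k a t) = NormedSpace.exp ((t : ℂ) • X a)) (hG : ∀ g : G, ∃ a t, k a t = g)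
    (hcen : ∀ (a : K) (t : ℝ) (g : G), g * k a t = k a t * g) {β : ℝ}
    {μ : Measure (LGConfig d G)} [IsProbabilityMeasure μ]
    (hμ : IsSchwingerDysonStateOn (fun f => f ∈ polyFunctions (ι := ZdEdge d) r ∧ IsZdGaugeInvariant f)
      k (fun e => wilsonBoundaryAction r.ρ {e}) β μ) :
    avgMeasure (gaugeTransformZd (d := d) (G := G)) μ ∈ ymGibbsMeasures r.ρ β := by
  haveI := isProbabilityMeasure_avgMeasure (act := gaugeTransformZd (d := d) (G := G))
    gaugeTransformZd_action.2 μ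
  have hS : ∀ e : ZdEdge d, wilsonBoundaryAction r.ρ {e} ∈ polyFunctions (ι := ZdEdge d) r :=
    fun e => wilsonBoundaryAction_mem_polyFunctions r {e}
  have hSd : ∀ (e : ZdEdge d) (a : K), ∃ S' : LGConfig d G → ℝ, Continuous S' ∧
      ∀ U, HasDerivAt (fun t => wilsonBoundaryAction r.ρ {e} (Function.update U e (k a t * U e)))
        (S' U) 0 :=
    fun e a => exists_hasDerivAt_of_mem_polyFunctions r (hk a) (hX a) e (hS e)
  have hpoly : IsPolySchwingerDysonState r k (fun e => wilsonBoundaryAction r.ρ {e}) β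
      (avgMeasure (gaugeTransformZd (d := d) (G := G)) μ) :=
    hμ.isPolySchwingerDysonState_avgMeasure r hkc hk gaugeTransformZd_action.2
      gaugeTransformZd_action.1 (gaugeTransformZd_hgen r)
      (fun h e a t U => gaugeTransformZd_update_mul_of_central (hcen a t) h U e)
      (fun h e U => wilsonBoundaryAction_gaugeTransformZd r.ρ {e} h U)
  exact (isSchwingerDysonState_iff_mem_ymGibbsMeasures r.ρ hkc hk hG r.continuous hSd β _).1
    (hpoly.isSchwingerDysonState r hkc hk hX hG hS)

/-- ★★★ **`U(1)` ON `ℤ^d`, GAUGE-INVARIANT STATE: the loop equations for gauge-invariant POLYNOMIAL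
observables hold iff the state is an infinite-volume Gibbs (DLR) state** (every `d`, real `β`).
UNCONDITIONAL. [folklore] -/
theorem sdOn_gaugeInvariantPoly_iff_mem_ymGibbsMeasures_u1 (β : ℝ)
    (μ : Measure (LGConfig d (Matrix.unitaryGroup (Fin 1) ℂ))) [IsProbabilityMeasure μ]
    (hμinv : ∀ g : Site d → Matrix.unitaryGroup (Fin 1) ℂ, μ.map (gaugeTransformZd g) = μ) :
    IsSchwingerDysonStateOn
        (fun f => f ∈ polyFunctions (ι := ZdEdge d) (unitaryFundamentalLatticeRep 1) ∧
          IsZdGaugeInvariant f)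
        (uExp 1) (fun e => wilsonBoundaryAction (unitaryFundamentalRep (Fin 1) ℂ) {e}) β μ ↔
      μ ∈ ymGibbsMeasures (unitaryFundamentalRep (Fin 1) ℂ) β :=
  sdOn_gaugeInvariantPoly_iff_mem_ymGibbsMeasures (unitaryFundamentalLatticeRep 1) (continuous_uExp 1)
    (uExp_add 1) (X := fun X : UGenerator 1 => (X : Matrix (Fin 1) (Fin 1) ℂ)) (rho_uExp 1)
    (fun g => exists_uExp_eq 1 g) (fun _ _ g => unitaryGroup_fin_one_comm g _) β μ hμinv

/-- ★★★ **`U(1)` ON `ℤ^d`, ANY STATE: the gauge average of a probability solution of the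
gauge-invariant polynomial loop equations is a DLR state.** UNCONDITIONAL. [folklore] -/
theorem avgMeasure_mem_ymGibbsMeasures_of_sdOn_gaugeInvariantPoly_u1 {β : ℝ}
    {μ : Measure (LGConfig d (Matrix.unitaryGroup (Fin 1) ℂ))} [IsProbabilityMeasure μ]
    (hμ : IsSchwingerDysonStateOn
      (fun f => f ∈ polyFunctions (ι := ZdEdge d) (unitaryFundamentalLatticeRep 1) ∧
        IsZdGaugeInvariant f)
      (uExp 1) (fun e => wilsonBoundaryAction (unitaryFundamentalRep (Fin 1) ℂ) {e}) β μ) :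
    avgMeasure (gaugeTransformZd (d := d) (G := Matrix.unitaryGroup (Fin 1) ℂ)) μ ∈
      ymGibbsMeasures (unitaryFundamentalRep (Fin 1) ℂ) β :=
  avgMeasure_mem_ymGibbsMeasures_of_sdOn_gaugeInvariantPoly (unitaryFundamentalLatticeRep 1)
    (continuous_uExp 1) (uExp_add 1) (X := fun X : UGenerator 1 => (X : Matrix (Fin 1) (Fin 1) ℂ))
    (rho_uExp 1) (fun g => exists_uExp_eq 1 g) (fun _ _ g => unitaryGroup_fin_one_comm g _) hμ

end Zd

end Summit.QuantumFields.GaugeBoot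

end
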